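import Mathlib
import HarnessLib
import Summits.Ventures.LatticeQCDFlow.Exactness.SUNResidualLayerVelocity
import Literature.MathematicalPhysics.QuantumFieldTheory.Luscher2010.TrivializingMaps
import Literature.Analysis.Calculus.ExpLocalLieSubalgebra

/-!
# The `SU(N)` residual layer as an isotopy: tangential derivatives of `U ↦ e^{τ Q(U)} U` on the lattice, for every `N`

HONEST FRAMING: exact (Metropolis-corrected) sampling algorithms for lattice gauge theory;
figures of merit are autocorrelation/cost numbers at stated couplings and volumes; no
continuum-physics claim.

Venture `LatticeQCDFlow` (cell pub-lqcd), topic `Exactness`; FANOUT row 10 (`eng-equiv`; engine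
modules `equiv/residual.py`, `flows_jax/residual_flow.py`).  NEW WORK of the cell, file 2 of the series on
the residual-layer Jacobian for every `N` (file 1: `SUNResidualLayerVelocity`).  Setting: the
masked residual layer of `SUNResidualLayerEquiv` — active links `a` (mask `p`) are replaced by
`e^{Q a y (U a)} U a`, the exponent read from the frozen links `y`, with the engine's certificate
(values in `𝔰𝔲(n)`, `κ a y`-Lipschitz in the Frobenius norm, `0 ≤ κ a y < 1`) — together with an
AMBIENT `C²` REALISATION `Qamb a : M_n(ℂ)^E → M_n(ℂ)` of each exponent (`Qamb a (coe U) = Q a y (U a)`;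
every engine exponent — stout, stout-defect, plaquette-potential, conditioner-weighted loop sums — is
a polynomial in the link entries and their conjugates, hence has one).  No definition is introduced:
the isotopy `famb τ W = (e ↦ e^{τ Qamb a W} W a` on active, `W e` on frozen links`)` is a
local notation.

* `contDiff_residualIsotopy` (`C²` jointly in `(τ, W)`), `residualIsotopy_mem` (maps `SU(n)^E` to
  itself), `hasDerivAt_residualIsotopy_tau` (`∂_τ famb = Q · famb` on active links),
  `residualIsotopy_zero`;
* the TANGENTIAL DERIVATIVE at a configuration `U ∈ SU(n)^E` in the direction `X U_a` supported on
  one active link `a`, `X ∈ 𝔰𝔲(n)` (the curve `r ↦ U[a ↦ e^{rX} U_a]` and file 1):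
  `fderiv_residualIsotopy_single_of_ne` (all other components vanish — the mask axiom: an active
  link's exponent reads only frozen links and the link itself), `fderiv_residualIsotopy_single_self`
  (the `a`-component `δ` has `δ · (famb a)ᴴ ∈ 𝔰𝔲(n)` and `(1 − |τ| κ) ‖X‖_F ≤ ‖δ‖_F`);
* later files: the tangential OPERATOR and its invertibility (`SUNResidualTangentOperator`), the
  `C¹` tangent GENERATOR of the inverse family (`SUNResidualFlowGenerator`), and the exactness of the
  layer for product Haar from Lüscher's Jacobian formula (`SUNResidualLayerJacobian`).

Printed counterparts, NAMED ONLY: M. Lüscher, CMP 293 (2010) 899, §3; Abbott et al.,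
arXiv:2305.02402 §4.2; Morningstar–Peardon, PRD 69 (2004) 054501.
-/

noncomputable section

namespace Summit.Ventures.LatticeQCDFlow.Exactness

open Literature.MathematicalPhysics.QuantumFieldTheory
open Literature.MathematicalPhysics.QuantumFieldTheory.Luscher2010
open Literature.MathematicalPhysics.QuantumFieldTheory.WilsonFlow
open Filter Set
open scoped Matrix Matrix.Norms.Frobenius Topology ContDiff Manifold

variable {d L n : ℕ} [NeZero L]

section Isotopy

variable (p : Edge d L → Prop) [DecidablePred p]
  (Q : {e : Edge d L // p e} → ({f : Edge d L // ¬p f} → Matrix.specialUnitaryGroup (Fin n) ℂ) →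
    Matrix (Fin n) (Fin n) ℂ → Matrix (Fin n) (Fin n) ℂ)
  (κ : {e : Edge d L // p e} → ({f : Edge d L // ¬p f} → Matrix.specialUnitaryGroup (Fin n) ℂ) → ℝ)
  (Qamb : {e : Edge d L // p e} → AmbConfig d L n → Matrix (Fin n) (Fin n) ℂ)

set_option quotPrecheck false in
/-- The residual isotopy at time `τ` on ambient configurations (local notation, not a definition):
`famb[τ] W e = e^{τ • Qamb a W} W e` on active links, `W e` on frozen links. -/
local notation "famb[" τ "]" => (fun (W : AmbConfig d L n) (e : Edge d L) =>
  if h : p e then NormedSpace.exp ((τ : ℝ) • Qamb ⟨e, h⟩ W) * W e else W e)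

/-! ## The isotopy: smoothness, values in `SU(n)^E`, time derivative -/

/-- **The residual isotopy is jointly `C²` in `(τ, W)`** when the ambient exponents are `C²`. -/
theorem contDiff_residualIsotopy (hQ2 : ∀ a, ContDiff ℝ 2 (Qamb a)) :
    ContDiff ℝ 2 (fun q : ℝ × AmbConfig d L n => famb[q.1] q.2) := by
  refine contDiff_pi.2 fun e => ?_
  by_cases he : p e
  · simp only [he, ↓reduceDIte]
    exact ((Literature.Analysis.Calculus.contDiff_exp (𝔸 := Matrix (Fin n) (Fin n) ℂ)).comp
      (contDiff_fst.smul ((hQ2 ⟨e, he⟩).comp contDiff_snd))).mul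
      ((contDiff_eval e).comp contDiff_snd)
  · simp only [he, ↓reduceDIte]
    exact (contDiff_eval e).comp contDiff_snd

/-- The residual isotopy at a fixed time is `C²` (hence differentiable) in the configuration. -/
theorem contDiff_residualIsotopy_right (hQ2 : ∀ a, ContDiff ℝ 2 (Qamb a)) (τ : ℝ) :
    ContDiff ℝ 2 (famb[τ]) :=
  (contDiff_residualIsotopy p Qamb hQ2).comp (contDiff_const.prodMk contDiff_id)

omit [NeZero L] [DecidablePred p] in
/-- At an `SU(n)^E` configuration the realised exponent is the engine's fibre exponent, hence lies in
`𝔰𝔲(n)`. -/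
theorem residualIsotopyExponent_skew
    (hQ : ∀ a y, ∀ U ∈ Matrix.specialUnitaryGroup (Fin n) ℂ, (Q a y U)ᴴ = -Q a y U ∧ (Q a y U).trace = 0)
    (hQambQ : ∀ a (U : GaugeConfig d L (Matrix.specialUnitaryGroup (Fin n) ℂ)),
      Qamb a (coeConfig U) = Q a (fun f => U f) (U a.1 : Matrix (Fin n) (Fin n) ℂ))
    (a : {e : Edge d L // p e}) (U : GaugeConfig d L (Matrix.specialUnitaryGroup (Fin n) ℂ)) (τ : ℝ) :
    (τ • Qamb a (coeConfig U))ᴴ = -(τ • Qamb a (coeConfig U)) ∧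
      (τ • Qamb a (coeConfig U)).trace = 0 := by
  obtain ⟨h1, h2⟩ := hQ a (fun f => U f) _ (U a.1).2
  rw [hQambQ]
  refine ⟨?_, ?_⟩
  · rw [Matrix.conjTranspose_smul, h1, star_trivial, smul_neg]
  · rw [Matrix.trace_smul, h2, smul_zero]

omit [NeZero L] in
/-- **The isotopy maps `SU(n)^E` to itself** at every time. -/
theorem residualIsotopy_mem
    (hQ : ∀ a y, ∀ U ∈ Matrix.specialUnitaryGroup (Fin n) ℂ, (Q a y U)ᴴ = -Q a y U ∧ (Q a y U).trace = 0)
    (hQambQ : ∀ a (U : GaugeConfig d L (Matrix.specialUnitaryGroup (Fin n) ℂ)),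
      Qamb a (coeConfig U) = Q a (fun f => U f) (U a.1 : Matrix (Fin n) (Fin n) ℂ))
    (τ : ℝ) (U : GaugeConfig d L (Matrix.specialUnitaryGroup (Fin n) ℂ)) (e : Edge d L) :
    (famb[τ]) (coeConfig U) e ∈ Matrix.specialUnitaryGroup (Fin n) ℂ := by
  by_cases he : p e
  · simp only [he, ↓reduceDIte, coeConfig_apply]
    obtain ⟨h1, h2⟩ := residualIsotopyExponent_skew p Q Qamb hQ hQambQ ⟨e, he⟩ U τ
    exact Submonoid.mul_mem _ (exp_mem_specialUnitaryGroup h1 h2) (U e).2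
  · simp only [he, ↓reduceDIte, coeConfig_apply]
    exact (U e).2

omit [NeZero L] in
/-- At time `0` the isotopy is the identity. -/
theorem residualIsotopy_zero (W : AmbConfig d L n) : (famb[(0 : ℝ)]) W = W := by
  funext e
  by_cases he : p e
  · simp only [he, ↓reduceDIte, zero_smul, NormedSpace.exp_zero, one_mul]
  · simp only [he, ↓reduceDIte]

omit [NeZero L] in
/-- **Time derivative of the isotopy**: `∂_τ famb[τ] W = (Qamb a W · famb[τ] W a` on active links,
`0` on frozen links`)`. -/
theorem hasDerivAt_residualIsotopy_tau (W : AmbConfig d L n) (τ : ℝ) :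
    HasDerivAt (fun τ' : ℝ => (famb[τ']) W)
      (fun e => if h : p e then Qamb ⟨e, h⟩ W * (famb[τ]) W e else 0) τ := by
  refine hasDerivAt_pi.2 fun e => ?_
  by_cases he : p e
  · simp only [he, ↓reduceDIte]
    have h := (hasDerivAt_exp_smul_const' (𝕂 := ℝ) (Qamb ⟨e, he⟩ W) τ).mul_const (W e)
    rw [mul_assoc] at h
    exact h
  · simp only [he, ↓reduceDIte]
    exact hasDerivAt_const τ (W e)

/-! ## Tangential derivatives along one active link -/

omit [NeZero L] in
/-- The one-parameter curve of configurations `r ↦ U[a ↦ e^{rX} U_a]` (ambient) has velocity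
`single a (X U_a)` at `r = 0` and starts at `U`. -/
theorem hasDerivAt_update_exp_smul (W : AmbConfig d L n) (a : Edge d L) (X : Matrix (Fin n) (Fin n) ℂ) :
    HasDerivAt (fun r : ℝ => Function.update W a (NormedSpace.exp (r • X) * W a))
      (Pi.single a (X * W a)) 0 := by
  refine hasDerivAt_pi.2 fun b => ?_
  rcases eq_or_ne b a with rfl | hb
  · simp only [Function.update_self, Pi.single_eq_same]
    exact hasDerivAt_exp_smul_mul (W b) X
  · simp only [Function.update_of_ne hb, Pi.single_eq_of_ne hb]
    exact hasDerivAt_const 0 (W b)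

omit [NeZero L] in
/-- The curve `r ↦ U[a ↦ e^{rX} U_a]` read in `SU(n)^E`: the ambient update is the `coeConfig` of
the updated `SU(n)` configuration. -/
theorem update_coeConfig_eq (U : GaugeConfig d L (Matrix.specialUnitaryGroup (Fin n) ℂ)) (a : Edge d L)
    (u : Matrix.specialUnitaryGroup (Fin n) ℂ) :
    Function.update (coeConfig U) a (u : Matrix (Fin n) (Fin n) ℂ) = coeConfig (Function.update U a u) := by
  funext b
  rcases eq_or_ne b a with rfl | hb
  · simp only [Function.update_self, coeConfig_apply]
  · simp only [Function.update_of_ne hb, coeConfig_apply]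

/-- The composite curve `r ↦ famb[τ] (U[a ↦ e^{rX} U_a])` has velocity
`D_W famb[τ](U) · single a (X U_a)` at `r = 0`. -/
theorem hasDerivAt_residualIsotopy_comp_update (hQ2 : ∀ a, ContDiff ℝ 2 (Qamb a)) (τ : ℝ)
    (W : AmbConfig d L n) (a : Edge d L) (X : Matrix (Fin n) (Fin n) ℂ) :
    HasDerivAt (fun r : ℝ => (famb[τ]) (Function.update W a (NormedSpace.exp (r • X) * W a)))
      (fderiv ℝ (famb[τ]) W (Pi.single a (X * W a))) 0 := by
  have hdiff : DifferentiableAt ℝ (famb[τ]) W :=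
    ((contDiff_residualIsotopy_right p Qamb hQ2 τ).differentiable (by norm_num)).differentiableAt
  have h0 : Function.update W a (NormedSpace.exp ((0 : ℝ) • X) * W a) = W := by
    rw [zero_smul, NormedSpace.exp_zero, one_mul, Function.update_eq_self]
  have hF : HasFDerivAt (famb[τ]) (fderiv ℝ (famb[τ]) W)
      (Function.update W a (NormedSpace.exp ((0 : ℝ) • X) * W a)) := by
    rw [h0]
    exact hdiff.hasFDerivAt
  exact hF.comp_hasDerivAt (0 : ℝ) (hasDerivAt_update_exp_smul W a X)

/-- **Cross components vanish** (the mask axiom): at `U ∈ SU(n)^E`, for an active link `a`,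
`X ∈ 𝔰𝔲(n)` and every link `b ≠ a`, `(D_W famb[τ](U) · single a (X U_a))_b = 0` — the exponent of an
active link `b` reads only `U_b` and frozen links, none of which moves along `r ↦ U[a ↦ e^{rX}U_a]`. -/
theorem fderiv_residualIsotopy_single_of_ne (hQ2 : ∀ a, ContDiff ℝ 2 (Qamb a))
    (hQambQ : ∀ a (U : GaugeConfig d L (Matrix.specialUnitaryGroup (Fin n) ℂ)),
      Qamb a (coeConfig U) = Q a (fun f => U f) (U a.1 : Matrix (Fin n) (Fin n) ℂ))
    (τ : ℝ) (U : GaugeConfig d L (Matrix.specialUnitaryGroup (Fin n) ℂ)) {a : Edge d L} (ha : p a)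
    {X : Matrix (Fin n) (Fin n) ℂ} (hX : Xᴴ = -X) (hX0 : X.trace = 0) {b : Edge d L} (hb : b ≠ a) :
    fderiv ℝ (famb[τ]) (coeConfig U) (Pi.single a (X * (U a : Matrix (Fin n) (Fin n) ℂ))) b = 0 := by
  have hcomp := (hasDerivAt_pi.1
    (hasDerivAt_residualIsotopy_comp_update p Qamb hQ2 τ (coeConfig U) a X)) b
  -- along the curve the `b`-component is constant
  have hγmem : ∀ r : ℝ, NormedSpace.exp (r • X) * (U a : Matrix (Fin n) (Fin n) ℂ) ∈
      Matrix.specialUnitaryGroup (Fin n) ℂ := exp_smul_mul_mem_specialUnitaryGroup (U a).2 hX hX0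
  have hconst : ∀ r : ℝ, (famb[τ]) (Function.update (coeConfig U) a
      (NormedSpace.exp (r • X) * (U a : Matrix (Fin n) (Fin n) ℂ))) b = (famb[τ]) (coeConfig U) b := by
    intro r
    have hup : Function.update (coeConfig U) a (NormedSpace.exp (r • X) * (U a : Matrix (Fin n) (Fin n) ℂ))
        = coeConfig (Function.update U a ⟨_, hγmem r⟩) := update_coeConfig_eq U a ⟨_, hγmem r⟩
    rw [hup]
    by_cases hpb : p b
    · simp only [hpb, ↓reduceDIte, coeConfig_apply, Function.update_of_ne hb]
      rw [hQambQ ⟨b, hpb⟩, hQambQ ⟨b, hpb⟩]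
      have hfro : (fun f : {f : Edge d L // ¬p f} => Function.update U a ⟨_, hγmem r⟩ f) =
          fun f : {f : Edge d L // ¬p f} => U f := by
        funext f
        have hfa : (f : Edge d L) ≠ a := fun h => f.2 (h ▸ ha)
        exact Function.update_of_ne hfa _ _
      rw [hfro]
      simp only [Function.update_of_ne hb]
    · simp only [hpb, ↓reduceDIte, coeConfig_apply, Function.update_of_ne hb]
  have hconst' : HasDerivAt (fun r : ℝ => (famb[τ]) (Function.update (coeConfig U) a
      (NormedSpace.exp (r • X) * (U a : Matrix (Fin n) (Fin n) ℂ))) b) 0 0 := by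
    have h1 : (fun r : ℝ => (famb[τ]) (Function.update (coeConfig U) a
        (NormedSpace.exp (r • X) * (U a : Matrix (Fin n) (Fin n) ℂ))) b) = fun _ => (famb[τ]) (coeConfig U) b :=
      funext hconst
    rw [h1]
    exact hasDerivAt_const 0 _
  exact hcomp.unique hconst'

/-- **The diagonal component**: at `U ∈ SU(n)^E`, for an active link `a` and `X ∈ 𝔰𝔲(n)`, the
`a`-component `δ = (D_W famb[τ](U) · single a (X U_a))_a` satisfies `δ (famb[τ] U a)ᴴ ∈ 𝔰𝔲(n)` and
`(1 − |τ| κ a y) ‖X‖_F ≤ ‖δ‖_F` (file 1's `residualCurve_velocity` for the exponent `τ Q a y`, which is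
`|τ| κ a y`-Lipschitz). -/
theorem fderiv_residualIsotopy_single_self (hQ2 : ∀ a, ContDiff ℝ 2 (Qamb a))
    (hQ : ∀ a y, ∀ U ∈ Matrix.specialUnitaryGroup (Fin n) ℂ, (Q a y U)ᴴ = -Q a y U ∧ (Q a y U).trace = 0)
    (hlip : ∀ a y, ∀ U ∈ Matrix.specialUnitaryGroup (Fin n) ℂ, ∀ V ∈ Matrix.specialUnitaryGroup (Fin n) ℂ,
      frobNorm (Q a y U - Q a y V) ≤ κ a y * frobNorm (U - V))
    (hQambQ : ∀ a (U : GaugeConfig d L (Matrix.specialUnitaryGroup (Fin n) ℂ)),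
      Qamb a (coeConfig U) = Q a (fun f => U f) (U a.1 : Matrix (Fin n) (Fin n) ℂ))
    (τ : ℝ) (U : GaugeConfig d L (Matrix.specialUnitaryGroup (Fin n) ℂ)) {a : Edge d L} (ha : p a)
    {X : Matrix (Fin n) (Fin n) ℂ} (hX : Xᴴ = -X) (hX0 : X.trace = 0) :
    let δ := fderiv ℝ (famb[τ]) (coeConfig U) (Pi.single a (X * (U a : Matrix (Fin n) (Fin n) ℂ))) a
    let f := NormedSpace.exp (τ • Qamb ⟨a, ha⟩ (coeConfig U)) * (U a : Matrix (Fin n) (Fin n) ℂ)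
    ((δ * fᴴ)ᴴ = -(δ * fᴴ) ∧ (δ * fᴴ).trace = 0) ∧
      (1 - |τ| * κ ⟨a, ha⟩ (fun f : {f : Edge d L // ¬p f} => U f)) * frobNorm X ≤ frobNorm δ := by
  intro δ f
  have hcomp := (hasDerivAt_pi.1
    (hasDerivAt_residualIsotopy_comp_update p Qamb hQ2 τ (coeConfig U) a X)) a
  have hγmem : ∀ r : ℝ, NormedSpace.exp (r • X) * (U a : Matrix (Fin n) (Fin n) ℂ) ∈
      Matrix.specialUnitaryGroup (Fin n) ℂ := exp_smul_mul_mem_specialUnitaryGroup (U a).2 hX hX0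
  set y : {f : Edge d L // ¬p f} → Matrix.specialUnitaryGroup (Fin n) ℂ := fun f => U f with hy
  -- the `a`-component along the curve is the one-link residual map with exponent `τ • Q a y`
  have hcurve : ∀ r : ℝ, (famb[τ]) (Function.update (coeConfig U) a
      (NormedSpace.exp (r • X) * (U a : Matrix (Fin n) (Fin n) ℂ))) a =
      NormedSpace.exp ((fun u => τ • Q ⟨a, ha⟩ y u) (NormedSpace.exp (r • X) * (U a : Matrix (Fin n) (Fin n) ℂ))) *
        (NormedSpace.exp (r • X) * (U a : Matrix (Fin n) (Fin n) ℂ)) := by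
    intro r
    have hup : Function.update (coeConfig U) a (NormedSpace.exp (r • X) * (U a : Matrix (Fin n) (Fin n) ℂ))
        = coeConfig (Function.update U a ⟨_, hγmem r⟩) := update_coeConfig_eq U a ⟨_, hγmem r⟩
    rw [hup]
    simp only [ha, ↓reduceDIte, coeConfig_apply, Function.update_self]
    rw [hQambQ ⟨a, ha⟩]
    have hfro : (fun f : {f : Edge d L // ¬p f} => Function.update U a ⟨_, hγmem r⟩ f) = y := by
      funext f
      have hfa : (f : Edge d L) ≠ a := fun h => f.2 (h ▸ ha)
      exact Function.update_of_ne hfa _ _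
    rw [hfro]
    simp only [Function.update_self]
  have h0 : (famb[τ]) (Function.update (coeConfig U) a
      (NormedSpace.exp ((0 : ℝ) • X) * coeConfig U a)) a = f := by
    rw [zero_smul, NormedSpace.exp_zero, one_mul, Function.update_eq_self]
    simp only [ha, ↓reduceDIte, coeConfig_apply, f]
  -- hypotheses of file 1 for the exponent `τ • Q a y`
  have hQ' : ∀ u ∈ Matrix.specialUnitaryGroup (Fin n) ℂ,
      ((fun u => τ • Q ⟨a, ha⟩ y u) u)ᴴ = -(fun u => τ • Q ⟨a, ha⟩ y u) u ∧
      ((fun u => τ • Q ⟨a, ha⟩ y u) u).trace = 0 := by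
    intro u hu
    obtain ⟨h1, h2⟩ := hQ ⟨a, ha⟩ y u hu
    refine ⟨?_, ?_⟩
    · rw [Matrix.conjTranspose_smul, h1, star_trivial, smul_neg]
    · rw [Matrix.trace_smul, h2, smul_zero]
  have hlip' : ∀ u ∈ Matrix.specialUnitaryGroup (Fin n) ℂ, ∀ v ∈ Matrix.specialUnitaryGroup (Fin n) ℂ,
      frobNorm ((fun u => τ • Q ⟨a, ha⟩ y u) u - (fun u => τ • Q ⟨a, ha⟩ y u) v) ≤
        (|τ| * κ ⟨a, ha⟩ y) * frobNorm (u - v) := by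
    intro u hu v hv
    have h1 : frobNorm (τ • Q ⟨a, ha⟩ y u - τ • Q ⟨a, ha⟩ y v) = |τ| * frobNorm (Q ⟨a, ha⟩ y u - Q ⟨a, ha⟩ y v) := by
      rw [← smul_sub, ← Complex.coe_smul, frobNorm_smul, Complex.norm_real, Real.norm_eq_abs]
    rw [h1, mul_assoc]
    exact mul_le_mul_of_nonneg_left (hlip ⟨a, ha⟩ y u hu v hv) (abs_nonneg τ)
  have key := residualCurve_velocity hQ' hlip' (U a).2 hX hX0 hcomp hcurve
  rw [h0] at key
  exact key

end Isotopy

end Summit.Ventures.LatticeQCDFlow.Exactness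

end

/-! ## Frozen components of the derivative, and the elementary operators of the tangential calculus (GEN-13 append)

Two groups of lemmas used by every later file of the series (`SUNResidualTangentOperator`,
`SUNResidualFlowGenerator`, `SUNResidualLayerJacobian`, and the closed-form files
`SUNResidualTangentDerivative` … `SUNResidualLayerJacobianDet`):

* `fderiv_residualIsotopy_apply_of_not` — for a FROZEN link `e` the `e`-component of `famb[τ]` is the
  evaluation map, so `(D_W famb[τ](W) V)_e = V_e` for every direction `V` (complements
  `fderiv_residualIsotopy_single_of_ne` / `_single_self`, which describe the active components);
* `fderiv_mulRight_apply`, `fderiv_evalLink_apply`, `fderiv_singleLink_apply`, `fderiv_suProj_idem` —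
  right multiplication `Y ↦ Y m`, evaluation at a link, insertion at a link (`Pi.single`) read as
  Fréchet derivatives of themselves at `0`, and idempotency of `𝒫 = fderiv ℝ suProj 0` as an operator.
  Writing every factor of the tangential operator `Top[τ, W, a] = 𝒫 ∘ Blk ∘ 𝒫 + (1 − 𝒫)` as an
  `fderiv` of an explicit map keeps all operators of the series in ONE normed operator algebra.
-/

noncomputable section

namespace Summit.Ventures.LatticeQCDFlow.Exactness

open Literature.MathematicalPhysics.QuantumFieldTheory
open Literature.MathematicalPhysics.QuantumFieldTheory.Luscher2010
open Literature.MathematicalPhysics.QuantumFieldTheory.WilsonFlow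
open Filter Set
open scoped Matrix Matrix.Norms.Frobenius Topology ContDiff

variable {d L n : ℕ} [NeZero L]

section FrozenComponents

variable (p : Edge d L → Prop) [DecidablePred p]
  (Qamb : {e : Edge d L // p e} → AmbConfig d L n → Matrix (Fin n) (Fin n) ℂ)

set_option quotPrecheck false in
/-- The residual isotopy at time `τ` (local notation, as in the first part of this file). -/
local notation "famb[" τ "]" => (fun (W : AmbConfig d L n) (e : Edge d L) =>
  if h : p e then NormedSpace.exp ((τ : ℝ) • Qamb ⟨e, h⟩ W) * W e else W e)

/-- **Frozen components of the derivative.**  For a frozen link `e` (`¬ p e`) the `e`-component of the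
isotopy is the evaluation map `W ↦ W e`, so its derivative at any `W` in any direction `V` is `V e`. -/
theorem fderiv_residualIsotopy_apply_of_not (hQ2 : ∀ a, ContDiff ℝ 2 (Qamb a)) (τ : ℝ)
    (W V : AmbConfig d L n) {e : Edge d L} (he : ¬p e) :
    fderiv ℝ (famb[τ]) W V e = V e := by
  have hdiff : DifferentiableAt ℝ (famb[τ]) W :=
    ((contDiff_residualIsotopy_right p Qamb hQ2 τ).differentiable (by norm_num)).differentiableAt
  have h1 : HasFDerivAt (fun W' : AmbConfig d L n => (famb[τ]) W' e)
      ((ContinuousLinearMap.proj (R := ℝ) (φ := fun _ : Edge d L => Matrix (Fin n) (Fin n) ℂ) e).comp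
        (fderiv ℝ (famb[τ]) W)) W :=
    (ContinuousLinearMap.proj (R := ℝ) (φ := fun _ : Edge d L => Matrix (Fin n) (Fin n) ℂ) e).hasFDerivAt.comp
      W hdiff.hasFDerivAt
  have h2 : HasFDerivAt (fun W' : AmbConfig d L n => (famb[τ]) W' e)
      (ContinuousLinearMap.proj (R := ℝ) (φ := fun _ : Edge d L => Matrix (Fin n) (Fin n) ℂ) e) W := by
    have hfun : (fun W' : AmbConfig d L n => (famb[τ]) W' e) = fun W' => W' e := by
      funext W'
      simp only [he, ↓reduceDIte]
    rw [hfun]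
    exact (ContinuousLinearMap.proj (R := ℝ) (φ := fun _ : Edge d L => Matrix (Fin n) (Fin n) ℂ) e).hasFDerivAt
  have h3 := h1.unique h2
  exact congrArg (fun T : AmbConfig d L n →L[ℝ] Matrix (Fin n) (Fin n) ℂ => T V) h3

end FrozenComponents

/-! ## Elementary operators as Fréchet derivatives -/

omit [NeZero L] in
/-- Right multiplication `Y ↦ Y m` is its own derivative. -/
theorem fderiv_mulRight_apply (m X : Matrix (Fin n) (Fin n) ℂ) :
    fderiv ℝ (fun Y : Matrix (Fin n) (Fin n) ℂ => Y * m) 0 X = X * m := by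
  have h : fderiv ℝ (fun Y : Matrix (Fin n) (Fin n) ℂ => Y * m) 0 =
      (ContinuousLinearMap.mul ℝ (Matrix (Fin n) (Fin n) ℂ)).flip m :=
    ((ContinuousLinearMap.mul ℝ (Matrix (Fin n) (Fin n) ℂ)).flip m).hasFDerivAt.fderiv
  rw [h]
  rfl

omit [NeZero L] in
/-- Evaluation at a link is its own derivative. -/
theorem fderiv_evalLink_apply (a : Edge d L) (Y : AmbConfig d L n) :
    fderiv ℝ (fun W' : AmbConfig d L n => W' a) 0 Y = Y a := by
  have h : fderiv ℝ (fun W' : AmbConfig d L n => W' a) 0 =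
      ContinuousLinearMap.proj (R := ℝ) (φ := fun _ : Edge d L => Matrix (Fin n) (Fin n) ℂ) a :=
    (ContinuousLinearMap.proj (R := ℝ) (φ := fun _ : Edge d L => Matrix (Fin n) (Fin n) ℂ) a).hasFDerivAt.fderiv
  rw [h]
  rfl

omit [NeZero L] in
/-- Insertion at a link (`Pi.single`) is its own derivative. -/
theorem fderiv_singleLink_apply (a : Edge d L) (X : Matrix (Fin n) (Fin n) ℂ) :
    fderiv ℝ (fun Y : Matrix (Fin n) (Fin n) ℂ => (Pi.single a Y : AmbConfig d L n)) 0 X = Pi.single a X := by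
  have h : fderiv ℝ (fun Y : Matrix (Fin n) (Fin n) ℂ => (Pi.single a Y : AmbConfig d L n)) 0 =
      ContinuousLinearMap.single ℝ (fun _ : Edge d L => Matrix (Fin n) (Fin n) ℂ) a :=
    (ContinuousLinearMap.single ℝ (fun _ : Edge d L => Matrix (Fin n) (Fin n) ℂ) a).hasFDerivAt.fderiv
  rw [h]
  rfl

/-- `𝒫 = fderiv ℝ suProj 0` is idempotent as an operator. -/
theorem fderiv_suProj_idem (X : Matrix (Fin n) (Fin n) ℂ) :
    (fderiv ℝ (suProj (n := n)) 0) ((fderiv ℝ (suProj (n := n)) 0) X) = fderiv ℝ (suProj (n := n)) 0 X := by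
  rw [fderiv_suProj_apply, fderiv_suProj_apply, suProj_suProj]

end Summit.Ventures.LatticeQCDFlow.Exactness

end
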